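import Summits.QuantumFields.BalabanUV.Beta.EriceFlowEnclosureB12AsPrintedHistoryContagionShiftEnd

/-!
# Beta / EriceFlowEnclosureB12AsPrintedHistoryContagionShiftPin — ASYMPTOTIC FREEDOM IS CONTAGIOUS, part 9: the PIN DEPENDENCE.  Two same-depth in-box runs
# pinned at small renormalized couplings e ≤ e′ are, in the chart x = 1∕g², within a factor [2∕3, 4∕3] of their endpoint separation AT EVERY INDEX
# (`(2∕3)(1∕e² − 1∕e′²) ≤ 1∕g_j² − 1∕g′_j² ≤ (4∕3)(1∕e² − 1∕e′²)`) — a sup-norm fixed point over the contagion profiles; hence, with part 5∕6, the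
# CONTINUUM RUNNING COUPLING IS A BI-LIPSCHITZ, STRICTLY MONOTONE FUNCTION OF THE RENORMALIZED COUPLING in that chart, uniformly in the physical scale,
# and on the as-printed carrier this follows from [I] THEOREM 2 AS TYPED + NE4 + coupling-chart fading memory for ALL pinned row families (any torus
# exponents; no `Definitions`, no uniqueness input) — part 7's «≤» upgraded to a two-sided quantitative law (β-flow team, prover 1, unit
# `b2b-balaban-beta-bflow-p1`, gen 36; ROW AP-I·Uc × NODE U2; parts 5–8 `…HistoryContagionShift*`)

HONEST FRAMING (page 1 of everything the β sub-cell writes): discharging `BetaPertH` makes Bałaban's UV stability UNCONDITIONAL — a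
real constructive-QFT result; it is NOT the continuum limit and NOT the Clay problem.  HONEST DEPENDENCY (cell reorg 2026-08-19,
verbatim): «continuum YM on T⁴ ⇐ BetaPertH ∧ nine spine estimates (0/9 proved); BetaPertH ⇐ (D1) ∧ (D4) ∧ CAP+tail; G-an2-4 gates
asym, D1 and NE2/3/4.»  THIS MODULE DISCHARGES NOTHING: [folklore] finite-sum ∕ limit bookkeeping over the printed recursion (0.20) (`FlowStep.RGEqH`,
telescoped `inv_sq_telescopeH`) under node U2's HYPOTHESIS SHAPES `HistLipschitz Λ γ` ∕ `FadingMemory C θ Λ` (NOT PRINTED, GAPS G-t4-U2-2), NE4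
`ScaleShiftRate` (NOT PRINTED, G-t4-U2-1) and a (0.31)-reference run (the shape [I] Theorem 2 p. 259 — STATED WITHOUT PROOF — asserts; part 6 takes it
from `Theorem2Statement` AS TYPED), composed BY NAME with part 2's `inv_sq_lower_of_reference` ∕ `threshold_exists`, part 5's `injectedRate_of_reference`,
part 6's `referenceFamily_of_typedTheorem2` and node U2's `T4ContinuumCoupling.tendsto_invSq`.  [I] = T. Bałaban, Commun. Math. Phys. **109** (1987)
[Balaban1987RG1]; the abstract family is `S.β` of a `B12BetaAsPrinted.Setting`; NOTHING is asserted about Bałaban's β.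

THE POINT.  Gen 33∕35's uniqueness kernels pin two runs at the SAME coupling (δ_K = 0) and contract δ ≡ 0; node U2's two-sided kernel pins consecutive
cutoffs.  Here the pins DIFFER: Δ_j := 1∕g_j² − 1∕g′_j², Δ_K = D.  Telescoping (0.20) along both runs, `Δ_j − Δ_K = Σ_{l∈[j,K)} (β_{l+1}(g_{≤l}) − β_{l+1}(g′_{≤l}))`,
and the moduli with `|g_i − g′_i| ≤ g_i²g′_i·|Δ_i|` bound the sum by `C·M·Σ_l Σ_{i≤l} θ^{l−i} g_i²g′_i ≤ (CU∕(1−θ))·M`, M = max_i |Δ_i|, U the AF weight sum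
— which the CONTAGION profiles of both runs (quarter rate from their own small endpoints, ONE shared reference run) make `≤ 8e′³ + 16e′∕β*` (§9).  So
`M ≤ D + qM`, q = CU∕(1−θ) ≤ ¼ below a threshold in e′ alone, whence `M ≤ 4D∕3` and `|Δ_j − D| ≤ D∕3`: THE WHOLE RUN DEPENDS ON ITS PIN BI-LIPSCHITZ-LY,
uniformly in the depth and the index, with NO asymptotic-freedom letter, NO sign, NO `Definitions`, NO uniqueness input (uniqueness, D = 0, is the
special case).  §10 passes to the continuum limit of part 5 (both families have `InjectedRate`): `(2∕3)(1∕g² − 1∕g′²) ≤ 1∕gstar(m)² − 1∕gstar′(m)² ≤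
(4∕3)(1∕g² − 1∕g′²)` at EVERY physical scale m — the continuum running coupling is STRICTLY increasing and bi-Lipschitz in the renormalized one (chart 1∕g²);
§11 reads it on the carrier from Theorem 2 AS TYPED for all pinned row families below one threshold.

WHAT THIS FILE PROVES (0 sorry, 0 def): §9 `sum_Ico_sum_range_geom_le` (the swapped double sum ≤ U∕(1−θ)), `sum_weights_le_of_profiles_le` (U for pins e ≤ e′),
**`sep_sub_sep_le_of_reference`** (|Δ_j − Δ_K| ≤ |Δ_K|∕3), **`sep_twoSided_of_reference`** (the signed sandwich); §10 **`astar_twoSided_of_reference`**,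
`threshold_exists_quarter`; §11 **`astar_biLipschitz_of_typedTheorem2`** (carrier: strictly monotone + bi-Lipschitz, all pinned row families, any torus exponents).
NOT CLAIMED: any letter for Bałaban's β; Theorem 2; `BetaPertH`; continuum limit of the measures; Clay.
-/

namespace Summit.QuantumFields.BalabanUV.Beta.EriceFlowEnclosureB12AsPrintedHistoryContagionShiftPin

open Finset Filter Topology
open Literature.MathematicalPhysics.QuantumFieldTheory.Balaban1983to89
open Literature.MathematicalPhysics.QuantumFieldTheory.Balaban1983to89.B12BetaAsPrinted
open Literature.MathematicalPhysics.QuantumFieldTheory.Balaban1983to89.FlowStep (prefixOf Box mem_box RGEqH)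
open Literature.MathematicalPhysics.QuantumFieldTheory.Balaban1983to89.T4CouplingMatching (HistLipschitz FadingMemory ScaleShiftRate prof sprof
  sprof_pos sprof_sq prof_pos disc abs_sub_le_of_inv_sq sum_profWeights_le)
open Literature.MathematicalPhysics.QuantumFieldTheory.Balaban1983to89.T4CauchySum (InjectedRate)
open Literature.MathematicalPhysics.QuantumFieldTheory.Balaban1983to89.T4ContinuumCoupling (invSq astar gstar tendsto_invSq)
open Summit.QuantumFields.BalabanUV.Beta.EriceFlowEnclosureB12AsPrintedHistoryContagion (geom_shift_le)
open Summit.QuantumFields.BalabanUV.Beta.EriceFlowEnclosureB12AsPrintedHistoryContagionProfile (inv_sq_lower_of_reference threshold_exists)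
open Summit.QuantumFields.BalabanUV.Beta.EriceFlowEnclosureB12AsPrintedHistoryContagionShift (injectedRate_of_reference)
open Summit.QuantumFields.BalabanUV.Beta.EriceFlowEnclosureB12AsPrintedHistoryContagionShiftEnd (referenceFamily_of_typedTheorem2)

noncomputable section

variable {S : Setting}

/-! ## §9 Same depth, two pins: the sup-norm fixed point over the contagion profiles -/

/-- The swapped double sum of the fading rows against weights that are nonnegative below K: `Σ_{l∈[j,K)} Σ_{i≤l} θ^{l−i} u_i ≤ (1∕(1−θ)) Σ_{i<K} u_i`
(0 ≤ θ < 1). [folklore] -/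
theorem sum_Ico_sum_range_geom_le {θ : ℝ} {u : ℕ → ℝ} (hθ0 : 0 ≤ θ) (hθ1 : θ < 1) {j K : ℕ} (hu : ∀ i, i < K → 0 ≤ u i) :
    ∑ l ∈ Ico j K, ∑ i ∈ range (l + 1), θ ^ (l - i) * u i ≤ 1 / (1 - θ) * ∑ i ∈ range K, u i := by
  have hswap : ∑ l ∈ Ico j K, ∑ i ∈ range (l + 1), θ ^ (l - i) * u i = ∑ i ∈ range K, ∑ l ∈ Ico (max j i) K, θ ^ (l - i) * u i := by
    refine Finset.sum_comm' fun l i => ?_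
    simp only [mem_Ico, mem_range]
    omega
  rw [hswap, Finset.mul_sum]
  refine Finset.sum_le_sum fun i hi => ?_
  have hiK : i < K := mem_range.mp hi
  rw [← Finset.sum_mul, mul_comm (1 / (1 - θ)) (u i)]
  rw [mul_comm]
  refine mul_le_mul_of_nonneg_left ?_ (hu i hiK)
  calc ∑ l ∈ Ico (max j i) K, θ ^ (l - i) ≤ ∑ l ∈ Ico i K, θ ^ (l - i) :=
        Finset.sum_le_sum_of_subset_of_nonneg (fun l hl => by simp only [mem_Ico] at hl ⊢; omega) (fun _ _ _ => pow_nonneg hθ0 _)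
    _ ≤ 1 / (1 - θ) := geom_shift_le hθ0 hθ1 i K

/-- **THE AF WEIGHT SUM FOR TWO PINS e ≤ e′.**  Two runs with couplings > 0, `g_K = e ≤ e′ = g′_K`, each carrying the quarter-rate profile from its own endpoint:
`Σ_{i≤K} g_i² g′_i ≤ 8e′³ + 16e′∕β*` (the profile from e dominates the one from e′; node U2's `sum_profWeights_le` at base 2e′). [cite: Balaban1987RG1, Thm 2 (0.31) p.259] -/
theorem sum_weights_le_of_profiles_le {bs : ℝ} {K : ℕ} {g g' : ℕ → ℝ} (hbs : 0 < bs)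
    (hpos : ∀ i, i ≤ K → 0 < g i) (hpos' : ∀ i, i ≤ K → 0 < g' i) (hle : g K ≤ g' K)
    (hA : ∀ j, j ≤ K → 1 / (4 * (g K) ^ 2) + bs / 4 * ((K : ℝ) - j) ≤ 1 / (g j) ^ 2)
    (hB : ∀ j, j ≤ K → 1 / (4 * (g' K) ^ 2) + bs / 4 * ((K : ℝ) - j) ≤ 1 / (g' j) ^ 2) :
    ∑ i ∈ range (K + 1), (g i) ^ 2 * g' i ≤ 8 * (g' K) ^ 3 + 16 * g' K / bs := by
  have he := hpos K le_rfl
  have he' := hpos' K le_rfl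
  have h2e : 0 < 2 * g' K := by positivity
  have hb4 : 0 < bs / 4 := by positivity
  have hp0 := sprof_pos h2e hb4.le
  have hee : 1 / (4 * (g' K) ^ 2) ≤ 1 / (4 * (g K) ^ 2) :=
    one_div_le_one_div_of_le (by positivity) (by nlinarith [mul_le_mul hle hle he.le he'.le])
  have hprof : ∀ i, i ≤ K → prof (2 * g' K) (bs / 4) (K - i) = 1 / (4 * (g' K) ^ 2) + bs / 4 * ((K : ℝ) - i) := by
    intro i hi
    unfold T4CouplingMatching.prof
    rw [Nat.cast_sub hi]
    ring
  have hpt : ∀ i, i ≤ K →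
      (g i) ^ 2 * g' i ≤ 1 / (sprof (2 * g' K) (bs / 4) (K - i)) ^ 2 * (1 / sprof (2 * g' K) (bs / 4) (K - i)) := by
    intro i hi
    have hgi := hpos i hi
    have hgi' := hpos' i hi
    have ha : prof (2 * g' K) (bs / 4) (K - i) ≤ 1 / (g i) ^ 2 := by
      rw [hprof i hi]; exact (add_le_add hee le_rfl).trans (hA i hi)
    have ha' : prof (2 * g' K) (bs / 4) (K - i) ≤ 1 / (g' i) ^ 2 := by rw [hprof i hi]; exact hB i hi
    have hsq : (g i) ^ 2 ≤ 1 / (sprof (2 * g' K) (bs / 4) (K - i)) ^ 2 := by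
      rw [sprof_sq h2e hb4.le, le_one_div (pow_pos hgi 2) (prof_pos h2e hb4.le _)]; exact ha
    have hsq' : (g' i) ^ 2 ≤ (1 / sprof (2 * g' K) (bs / 4) (K - i)) ^ 2 := by
      rw [one_div_pow, sprof_sq h2e hb4.le, le_one_div (pow_pos hgi' 2) (prof_pos h2e hb4.le _)]; exact ha'
    have h' : g' i ≤ 1 / sprof (2 * g' K) (bs / 4) (K - i) :=
      (pow_le_pow_iff_left₀ hgi'.le (one_div_pos.mpr (hp0 _)).le two_ne_zero).mp hsq'
    exact mul_le_mul hsq h' hgi'.le (by positivity)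
  calc ∑ i ∈ range (K + 1), (g i) ^ 2 * g' i
      ≤ ∑ i ∈ range (K + 1), 1 / (sprof (2 * g' K) (bs / 4) (K - i)) ^ 2 * (1 / sprof (2 * g' K) (bs / 4) (K - i)) :=
        Finset.sum_le_sum fun i hi => hpt i (Nat.lt_succ_iff.mp (mem_range.mp hi))
    _ ≤ (2 * g' K) ^ 3 + 2 * (2 * g' K) / (bs / 4) := sum_profWeights_le h2e hb4 K
    _ = 8 * (g' K) ^ 3 + 16 * g' K / bs := by
        field_simp
        ring

/-- **THE SUP-NORM FIXED POINT (two pins).**  Two runs g, g′ of (0.20) of depth K with the same β, couplings in ]0, γ], moduli `HistLipschitz Λ γ S.β` with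
`FadingMemory C θ Λ` (0 ≤ θ < 1), AF weight sum `Σ_{i≤K} g_i² g′_i ≤ U` and the SMALLNESS `C·U ≤ (1 − θ)∕4`.  Then with Δ_j := 1∕g_j² − 1∕g′_j²:
**`|Δ_j − Δ_K| ≤ |Δ_K|∕3`** for every j ≤ K — telescoped (0.20), the moduli, `|g_i − g′_i| ≤ g_i²g′_i|Δ_i|`, the swapped double sum, and `M ≤ |Δ_K| + M∕4` for
M = max_i |Δ_i|. [cite: Balaban1987RG1, (0.20) p.256 with p.298] -/
theorem sep_sub_sep_le {γ θ C U : ℝ} {Λ : ℕ → ℕ → ℝ} {K : ℕ} {g g' : ℕ → ℝ}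
    (hθ0 : 0 ≤ θ) (hθ1 : θ < 1) (hC : 0 ≤ C)
    (hL : HistLipschitz Λ γ S.β) (hΛ : FadingMemory C θ Λ)
    (hg : RGEqH K S.β g) (hg' : RGEqH K S.β g')
    (hbox : ∀ i, i ≤ K → 0 < g i ∧ g i ≤ γ) (hbox' : ∀ i, i ≤ K → 0 < g' i ∧ g' i ≤ γ)
    (hU : ∑ i ∈ range (K + 1), (g i) ^ 2 * g' i ≤ U) (hsmall : C * U ≤ (1 - θ) / 4) :
    ∀ j, j ≤ K → |(1 / (g j) ^ 2 - 1 / (g' j) ^ 2) - (1 / (g K) ^ 2 - 1 / (g' K) ^ 2)| ≤ |1 / (g K) ^ 2 - 1 / (g' K) ^ 2| / 3 := by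
  have h1θ : 0 < 1 - θ := by linarith
  set δ : ℕ → ℝ := fun j => |1 / (g j) ^ 2 - 1 / (g' j) ^ 2| with hδ
  set u : ℕ → ℝ := fun i => (g i) ^ 2 * g' i with hu
  have hne : (range (K + 1)).Nonempty := ⟨0, by simp⟩
  set M := (range (K + 1)).sup' hne δ with hM
  have hMi : ∀ i, i ≤ K → δ i ≤ M := fun i hi => Finset.le_sup' δ (mem_range.mpr (Nat.lt_succ_of_le hi))
  have hM0 : 0 ≤ M := le_trans (abs_nonneg _) (hMi 0 (Nat.zero_le _))
  have hu0 : ∀ i, i ≤ K → 0 ≤ u i := fun i hi => mul_nonneg (sq_nonneg _) (hbox' i hi).1.le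
  have hU0 : 0 ≤ U := le_trans (Finset.sum_nonneg fun i hi => hu0 i (Nat.lt_succ_iff.mp (mem_range.mp hi))) hU
  -- telescoping (0.20) along both runs
  have htel : ∀ j, j ≤ K → (1 / (g j) ^ 2 - 1 / (g' j) ^ 2) - (1 / (g K) ^ 2 - 1 / (g' K) ^ 2)
      = ∑ l ∈ Ico j K, (S.β l (prefixOf g l) - S.β l (prefixOf g' l)) := by
    intro j hj
    rw [Finset.sum_sub_distrib, FlowStep.inv_sq_telescopeH hg hj le_rfl, FlowStep.inv_sq_telescopeH hg' hj le_rfl]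
    ring
  -- one scale
  have hscale : ∀ l, l < K → |S.β l (prefixOf g l) - S.β l (prefixOf g' l)| ≤ C * M * ∑ i ∈ range (l + 1), θ ^ (l - i) * u i := by
    intro l hl
    have hp := T4CouplingMatching.prefixOf_mem_box hl.le hbox
    have hp' := T4CouplingMatching.prefixOf_mem_box hl.le hbox'
    have h1 := hL l _ _ hp hp'
    have h2 : ∑ i : Fin (l + 1), Λ l i * |prefixOf g l i - prefixOf g' l i| ≤ ∑ i ∈ range (l + 1), C * M * (θ ^ (l - i) * u i) := by
      rw [Finset.sum_range (fun i => C * M * (θ ^ (l - i) * u i))]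
      refine Finset.sum_le_sum fun i _ => ?_
      have hil : (i : ℕ) ≤ l := Nat.lt_succ_iff.mp i.isLt
      have hiK : (i : ℕ) ≤ K := by omega
      have hgi := (hbox i hiK).1
      have hgi' := (hbox' i hiK).1
      simp only [FlowStep.prefixOf_apply]
      have hd : |g i - g' i| ≤ u i * δ i := abs_sub_le_of_inv_sq hgi hgi'
      have hΛi := hΛ l i hil
      calc Λ l i * |g i - g' i| ≤ (C * θ ^ (l - i)) * (u i * M) :=
            mul_le_mul hΛi.2 (hd.trans (mul_le_mul_of_nonneg_left (hMi i hiK) (hu0 i hiK))) (abs_nonneg _) (by positivity)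
        _ = C * M * (θ ^ (l - i) * u i) := by ring
    calc |S.β l (prefixOf g l) - S.β l (prefixOf g' l)| ≤ _ := h1
      _ ≤ ∑ i ∈ range (l + 1), C * M * (θ ^ (l - i) * u i) := h2
      _ = C * M * ∑ i ∈ range (l + 1), θ ^ (l - i) * u i := by rw [Finset.mul_sum]
  -- summed over [j, K): |Δ_j − Δ_K| ≤ (CU∕(1−θ))·M
  have hcore : ∀ j, j ≤ K → |(1 / (g j) ^ 2 - 1 / (g' j) ^ 2) - (1 / (g K) ^ 2 - 1 / (g' K) ^ 2)| ≤ C * U / (1 - θ) * M := by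
    intro j hj
    rw [htel j hj]
    calc |∑ l ∈ Ico j K, (S.β l (prefixOf g l) - S.β l (prefixOf g' l))|
        ≤ ∑ l ∈ Ico j K, |S.β l (prefixOf g l) - S.β l (prefixOf g' l)| := Finset.abs_sum_le_sum_abs _ _
      _ ≤ ∑ l ∈ Ico j K, C * M * ∑ i ∈ range (l + 1), θ ^ (l - i) * u i :=
          Finset.sum_le_sum fun l hl => hscale l (mem_Ico.mp hl).2
      _ = C * M * ∑ l ∈ Ico j K, ∑ i ∈ range (l + 1), θ ^ (l - i) * u i := by rw [Finset.mul_sum]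
      _ ≤ C * M * (1 / (1 - θ) * ∑ i ∈ range K, u i) :=
          mul_le_mul_of_nonneg_left (sum_Ico_sum_range_geom_le hθ0 hθ1 fun i hi => hu0 i hi.le) (by positivity)
      _ ≤ C * M * (1 / (1 - θ) * U) := by
          refine mul_le_mul_of_nonneg_left (mul_le_mul_of_nonneg_left ?_ (by positivity)) (by positivity)
          calc ∑ i ∈ range K, u i ≤ ∑ i ∈ range (K + 1), u i :=
                Finset.sum_le_sum_of_subset_of_nonneg (Finset.range_mono (by omega))
                  (fun i hi _ => hu0 i (by have := mem_range.mp hi; omega))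
            _ ≤ U := hU
      _ = C * U / (1 - θ) * M := by ring
  -- at the maximiser: M ≤ |Δ_K| + M∕4
  obtain ⟨i₀, hi₀, hMi₀⟩ := Finset.exists_mem_eq_sup' hne δ
  have hi₀K : i₀ ≤ K := Nat.lt_succ_iff.mp (mem_range.mp hi₀)
  have hq : C * U / (1 - θ) ≤ 1 / 4 := by rw [div_le_iff₀ h1θ]; linarith
  have hqM : C * U / (1 - θ) * M ≤ 1 / 4 * M := mul_le_mul_of_nonneg_right hq hM0
  have hMD : M ≤ |1 / (g K) ^ 2 - 1 / (g' K) ^ 2| + 1 / 4 * M := by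
    have h := hcore i₀ hi₀K
    have h2 := abs_sub_abs_le_abs_sub (1 / (g i₀) ^ 2 - 1 / (g' i₀) ^ 2) (1 / (g K) ^ 2 - 1 / (g' K) ^ 2)
    have e : M = δ i₀ := hMi₀
    have e' : δ i₀ = |1 / (g i₀) ^ 2 - 1 / (g' i₀) ^ 2| := rfl
    linarith
  intro j hj
  have h := hcore j hj
  linarith [abs_nonneg (1 / (g K) ^ 2 - 1 / (g' K) ^ 2)]

/-- **THE RUNS DEPEND ON THEIR PINS BI-LIPSCHITZ-LY (contagion form).**  Two runs g, g′ of (0.20) of depth K in ]0, γ], pinned at `e = g_K ≤ g′_K = e′`; ONE reference run t of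
depth K in ]0, γ] carrying (0.31)'s lower half from its end at rate β* > 0; moduli `HistLipschitz Λ γ S.β` with `FadingMemory C θ Λ` (0 ≤ θ < 1); smallness at the LARGER pin:
`4Ce′ ≤ β*(1 − θ)`, `e′²·Q(t_K) ≤ 3∕4`, `C(8e′³ + 16e′∕β*) ≤ (1 − θ)∕4`.  THEN at EVERY j ≤ K:
**`(2∕3)(1∕e² − 1∕e′²) ≤ 1∕g_j² − 1∕g′_j² ≤ (4∕3)(1∕e² − 1∕e′²)`** — in particular the runs are ORDERED index by index (no `Definitions`, no uniqueness input, rows of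
any kind), and pinned uniqueness (e = e′) is the special case. [cite: Balaban1987RG1, (0.20) p.256, Thm 2 (0.31) p.259, §5 p.298] -/
theorem sep_twoSided_of_reference {γ θ C bs : ℝ} {Λ : ℕ → ℕ → ℝ} {K : ℕ} {g g' t : ℕ → ℝ}
    (hθ0 : 0 ≤ θ) (hθ1 : θ < 1) (hC : 0 ≤ C) (hbs : 0 < bs)
    (hL : HistLipschitz Λ γ S.β) (hΛ : FadingMemory C θ Λ)
    (hg : RGEqH K S.β g) (hg' : RGEqH K S.β g') (ht : RGEqH K S.β t)
    (hbox : ∀ i, i ≤ K → 0 < g i ∧ g i ≤ γ) (hbox' : ∀ i, i ≤ K → 0 < g' i ∧ g' i ≤ γ)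
    (hboxt : ∀ i, i ≤ K → 0 < t i ∧ t i ≤ γ) (hle : g K ≤ g' K)
    (h031 : ∀ i, i ≤ K → 1 / (t K) ^ 2 + bs * ((K : ℝ) - i) ≤ 1 / (t i) ^ 2)
    (hs1 : 4 * C * g' K ≤ bs * (1 - θ))
    (hs2 : (g' K) ^ 2 * (C * γ / (1 - θ) ^ 2 + C / (1 - θ) * t K + (2 * C / ((1 - θ) * bs)) ^ 2 + 1 / (4 * (t K) ^ 2)) ≤ 3 / 4)
    (hs3 : C * (8 * (g' K) ^ 3 + 16 * g' K / bs) ≤ (1 - θ) / 4) :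
    ∀ j, j ≤ K → 2 / 3 * (1 / (g K) ^ 2 - 1 / (g' K) ^ 2) ≤ 1 / (g j) ^ 2 - 1 / (g' j) ^ 2 ∧
      1 / (g j) ^ 2 - 1 / (g' j) ^ 2 ≤ 4 / 3 * (1 / (g K) ^ 2 - 1 / (g' K) ^ 2) := by
  have he := (hbox K le_rfl).1
  have he' := (hbox' K le_rfl).1
  have htK := (hboxt K le_rfl).1
  have hγ : 0 ≤ γ := he.le.trans (hbox K le_rfl).2
  have h1θ : 0 < 1 - θ := by linarith
  have hQ0 : 0 ≤ C * γ / (1 - θ) ^ 2 + C / (1 - θ) * t K + (2 * C / ((1 - θ) * bs)) ^ 2 + 1 / (4 * (t K) ^ 2) := by positivity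
  -- the smallness conditions at the smaller pin
  have hs1e : 4 * C * g K ≤ bs * (1 - θ) := by nlinarith
  have hs2e : (g K) ^ 2 * (C * γ / (1 - θ) ^ 2 + C / (1 - θ) * t K + (2 * C / ((1 - θ) * bs)) ^ 2 + 1 / (4 * (t K) ^ 2)) ≤ 3 / 4 :=
    le_trans (mul_le_mul_of_nonneg_right (by nlinarith [mul_le_mul hle hle he.le he'.le]) hQ0) hs2
  have hpA := inv_sq_lower_of_reference hθ0 hθ1 hC hbs hL hΛ hg ht hbox hboxt h031 hs1e hs2e
  have hpB := inv_sq_lower_of_reference hθ0 hθ1 hC hbs hL hΛ hg' ht hbox' hboxt h031 hs1 hs2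
  have hU := sum_weights_le_of_profiles_le hbs (fun i hi => (hbox i hi).1) (fun i hi => (hbox' i hi).1) hle hpA hpB
  have hsep := sep_sub_sep_le hθ0 hθ1 hC hL hΛ hg hg' hbox hbox' hU hs3
  have hD0 : 0 ≤ 1 / (g K) ^ 2 - 1 / (g' K) ^ 2 :=
    sub_nonneg.mpr (one_div_le_one_div_of_le (pow_pos he 2) (by nlinarith [mul_le_mul hle hle he.le he'.le]))
  intro j hj
  have h := hsep j hj
  rw [abs_of_nonneg hD0] at h
  obtain ⟨h1, h2⟩ := abs_sub_le_iff.mp h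
  constructor <;> linarith

/-! ## §10 The continuum running coupling is bi-Lipschitz in the renormalized coupling (chart 1∕g²) -/

/-- Part 2's threshold with the weight-sum smallness tightened to `(1 − θ)∕4` (`threshold_exists` at 2C). [folklore] -/
theorem threshold_exists_quarter {γ θ C bs : ℝ} (gs : ℝ) (hγ : 0 ≤ γ) (hgs : 0 ≤ gs) (hθ1 : θ < 1) (hC : 0 ≤ C) (hbs : 0 < bs) :
    ∃ e₀ : ℝ, 0 < e₀ ∧ ∀ e : ℝ, 0 < e → e ≤ e₀ →
      4 * C * e ≤ bs * (1 - θ) ∧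
      e ^ 2 * (C * γ / (1 - θ) ^ 2 + C / (1 - θ) * gs + (2 * C / ((1 - θ) * bs)) ^ 2 + 1 / (4 * gs ^ 2)) ≤ 3 / 4 ∧
      C * (8 * e ^ 3 + 16 * e / bs) ≤ (1 - θ) / 4 := by
  have h1θ : 0 < 1 - θ := by linarith
  obtain ⟨e₀, he₀, h⟩ := threshold_exists (γ := γ) (θ := θ) (C := 2 * C) (bs := bs) gs hθ1 (by positivity) hbs
  refine ⟨e₀, he₀, fun e he hle => ?_⟩
  obtain ⟨h1, h2, h3⟩ := h e he hle
  have hQ : C * γ / (1 - θ) ^ 2 + C / (1 - θ) * gs + (2 * C / ((1 - θ) * bs)) ^ 2 + 1 / (4 * gs ^ 2)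
      ≤ 2 * C * γ / (1 - θ) ^ 2 + 2 * C / (1 - θ) * gs + (2 * (2 * C) / ((1 - θ) * bs)) ^ 2 + 1 / (4 * gs ^ 2) := by
    have a1 : C * γ / (1 - θ) ^ 2 ≤ 2 * C * γ / (1 - θ) ^ 2 := div_le_div_of_nonneg_right (by nlinarith) (by positivity)
    have a2 : C / (1 - θ) * gs ≤ 2 * C / (1 - θ) * gs := mul_le_mul_of_nonneg_right (div_le_div_of_nonneg_right (by linarith) h1θ.le) hgs
    have a3 : (2 * C / ((1 - θ) * bs)) ^ 2 ≤ (2 * (2 * C) / ((1 - θ) * bs)) ^ 2 := by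
      apply pow_le_pow_left₀ (by positivity)
      exact div_le_div_of_nonneg_right (by linarith) (by positivity)
    linarith
  have he8 : 0 ≤ 8 * e ^ 3 + 16 * e / bs := by positivity
  refine ⟨by nlinarith, le_trans (mul_le_mul_of_nonneg_left hQ (sq_nonneg e)) h2, by nlinarith⟩

/-- **THE CONTINUUM RUNNING COUPLING IS BI-LIPSCHITZ IN THE RENORMALIZED ONE (family form).**  Two families of runs of (0.20) in ]0, γ] pinned at g_IR ≤ g′_IR, ONE pinned
(0.31)-reference family (rate β*, endpoint g*), NE4 `ScaleShiftRate c θ γ S.β`, moduli with fading memory (0 < θ < 1), and the smallness at the larger pin g′_IR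
(`4Cg′ ≤ β*(1−θ)`, `g′²Q(g*) ≤ 3∕4`, `C(8g′³ + 16g′∕β*) ≤ (1−θ)∕4`).  THEN at EVERY physical scale m:
**`(2∕3)(1∕g_IR² − 1∕g′_IR²) ≤ astar g m − astar g′ m ≤ (4∕3)(1∕g_IR² − 1∕g′_IR²)`** — §9's sandwich along the two runs with n + m steps at index n, passed to node U2's
limits `tendsto_invSq` (part 5's `injectedRate_of_reference` for both families). [cite: Balaban1987RG1, (0.20) p.256, Thm 2 (0.31) p.259, §5 p.298] -/
theorem astar_twoSided_of_reference {γ θ C c bs gs gIR gIR' : ℝ} {Λ : ℕ → ℕ → ℝ} (g g' t : ℕ → ℕ → ℝ)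
    (hθ0 : 0 < θ) (hθ1 : θ < 1) (hC : 0 ≤ C) (hc : 0 ≤ c) (hbs : 0 < bs)
    (hS : ScaleShiftRate c θ γ S.β) (hL : HistLipschitz Λ γ S.β) (hΛ : FadingMemory C θ Λ)
    (hrun : ∀ K, RGEqH K S.β (g K)) (hbox : ∀ K i, i ≤ K → 0 < g K i ∧ g K i ≤ γ) (hpin : ∀ K, g K K = gIR)
    (hrun' : ∀ K, RGEqH K S.β (g' K)) (hbox' : ∀ K i, i ≤ K → 0 < g' K i ∧ g' K i ≤ γ) (hpin' : ∀ K, g' K K = gIR')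
    (hrunt : ∀ K, RGEqH K S.β (t K)) (hboxt : ∀ K i, i ≤ K → 0 < t K i ∧ t K i ≤ γ) (hpint : ∀ K, t K K = gs)
    (h031 : ∀ (K i : ℕ), i ≤ K → 1 / gs ^ 2 + bs * ((K : ℝ) - i) ≤ 1 / (t K i) ^ 2)
    (hle : gIR ≤ gIR')
    (hs1 : 4 * C * gIR' ≤ bs * (1 - θ))
    (hs2 : gIR' ^ 2 * (C * γ / (1 - θ) ^ 2 + C / (1 - θ) * gs + (2 * C / ((1 - θ) * bs)) ^ 2 + 1 / (4 * gs ^ 2)) ≤ 3 / 4)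
    (hs3 : C * (8 * gIR' ^ 3 + 16 * gIR' / bs) ≤ (1 - θ) / 4) (m : ℕ) :
    2 / 3 * (1 / gIR ^ 2 - 1 / gIR' ^ 2) ≤ astar g m - astar g' m ∧
      astar g m - astar g' m ≤ 4 / 3 * (1 / gIR ^ 2 - 1 / gIR' ^ 2) := by
  have h1θ : 0 < 1 - θ := by linarith
  have hgIR : 0 < gIR := by rw [← hpin 0]; exact (hbox 0 0 le_rfl).1
  have hgIR' : 0 < gIR' := by rw [← hpin' 0]; exact (hbox' 0 0 le_rfl).1
  have hgs : 0 < gs := by rw [← hpint 0]; exact (hboxt 0 0 le_rfl).1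
  have hγ : 0 ≤ γ := hgIR.le.trans (by rw [← hpin 0]; exact (hbox 0 0 le_rfl).2)
  have hQ0 : 0 ≤ C * γ / (1 - θ) ^ 2 + C / (1 - θ) * gs + (2 * C / ((1 - θ) * bs)) ^ 2 + 1 / (4 * gs ^ 2) := by positivity
  -- node U2's smallness (1−θ)∕2 at both pins, for the two `InjectedRate`s
  have hs1e : 4 * C * gIR ≤ bs * (1 - θ) := by nlinarith
  have hs2e : gIR ^ 2 * (C * γ / (1 - θ) ^ 2 + C / (1 - θ) * gs + (2 * C / ((1 - θ) * bs)) ^ 2 + 1 / (4 * gs ^ 2)) ≤ 3 / 4 :=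
    le_trans (mul_le_mul_of_nonneg_right (by nlinarith [mul_le_mul hle hle hgIR.le hgIR'.le]) hQ0) hs2
  have h83 : 8 * gIR ^ 3 + 16 * gIR / bs ≤ 8 * gIR' ^ 3 + 16 * gIR' / bs := by
    have : gIR ^ 3 ≤ gIR' ^ 3 := pow_le_pow_left₀ hgIR.le hle 3
    have : 16 * gIR / bs ≤ 16 * gIR' / bs := div_le_div_of_nonneg_right (by linarith) hbs.le
    linarith
  have hs3e : C * (8 * gIR ^ 3 + 16 * gIR / bs) ≤ (1 - θ) / 2 := by nlinarith [mul_le_mul_of_nonneg_left h83 hC]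
  have hs3' : C * (8 * gIR' ^ 3 + 16 * gIR' / bs) ≤ (1 - θ) / 2 := by linarith
  have hinj := injectedRate_of_reference g t hθ0 hθ1 hC hc hbs hS hL hΛ hrun hbox hpin hrunt hboxt hpint h031 hs1e hs2e hs3e
  have hinj' := injectedRate_of_reference g' t hθ0 hθ1 hC hc hbs hS hL hΛ hrun' hbox' hpin' hrunt hboxt hpint h031 hs1 hs2 hs3'
  have hT := (tendsto_invSq hθ1 hinj m).sub (tendsto_invSq hθ1 hinj' m)
  -- the sandwich at every cutoff
  have hpt : ∀ n, 2 / 3 * (1 / gIR ^ 2 - 1 / gIR' ^ 2) ≤ invSq g m n - invSq g' m n ∧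
      invSq g m n - invSq g' m n ≤ 4 / 3 * (1 / gIR ^ 2 - 1 / gIR' ^ 2) := by
    intro n
    have h031K : ∀ i, i ≤ n + m → 1 / (t (n + m) (n + m)) ^ 2 + bs * (((n + m : ℕ) : ℝ) - i) ≤ 1 / (t (n + m) i) ^ 2 :=
      fun i hi => by rw [hpint (n + m)]; exact h031 (n + m) i hi
    have hleK : g (n + m) (n + m) ≤ g' (n + m) (n + m) := by rw [hpin, hpin']; exact hle
    have hs1K : 4 * C * g' (n + m) (n + m) ≤ bs * (1 - θ) := by rw [hpin']; exact hs1
    have hs2K : (g' (n + m) (n + m)) ^ 2 * (C * γ / (1 - θ) ^ 2 + C / (1 - θ) * t (n + m) (n + m) + (2 * C / ((1 - θ) * bs)) ^ 2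
        + 1 / (4 * (t (n + m) (n + m)) ^ 2)) ≤ 3 / 4 := by rw [hpin', hpint]; exact hs2
    have hs3K : C * (8 * (g' (n + m) (n + m)) ^ 3 + 16 * g' (n + m) (n + m) / bs) ≤ (1 - θ) / 4 := by rw [hpin']; exact hs3
    have h := sep_twoSided_of_reference hθ0.le hθ1 hC hbs hL hΛ (hrun (n + m)) (hrun' (n + m)) (hrunt (n + m)) (hbox (n + m))
      (hbox' (n + m)) (hboxt (n + m)) hleK h031K hs1K hs2K hs3K n (Nat.le_add_right n m)
    rw [hpin, hpin'] at h
    simpa [T4ContinuumCoupling.invSq] using h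
  exact ⟨ge_of_tendsto hT (Eventually.of_forall fun n => (hpt n).1), le_of_tendsto hT (Eventually.of_forall fun n => (hpt n).2)⟩

/-! ## §11 On the carrier, from Theorem 2 AS TYPED: strictly monotone and bi-Lipschitz, for all pinned row families -/

/-- **THE CONTINUUM RUNNING COUPLING IS A STRICTLY INCREASING, BI-LIPSCHITZ FUNCTION OF THE RENORMALIZED COUPLING (chart 1∕g²) — from Theorem 2 AS TYPED.**
`Theorem2Statement S hL` (a HYPOTHESIS), the binder `hrg` on ]0, γ_u], NE4 `ScaleShiftRate c θ γ_u S.β`, `HistLipschitz Λ γ_u S.β` with `FadingMemory C θ Λ` (0 < θ < 1; γ_u ARBITRARY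
against (C, θ)) ⟹ for every m there is g₆ > 0 such that ANY two families of ROWS of the coupling table (depth K; any torus exponents, any bare couplings) in ]0, γ_u],
pinned at g ≤ g′ ≤ g₆, have at EVERY physical scale m′:
**`(2∕3)(1∕g² − 1∕g′²) ≤ 1∕(gstar m′)² − 1∕(gstar′ m′)² ≤ (4∕3)(1∕g² − 1∕g′²)`** (`astar = 1∕gstar²`), hence `gstar m′ < gstar′ m′` whenever g < g′ — part 7's «≤» made strict and
quantitative, with NO `Definitions`, NO uniqueness input, NO asymptotic-freedom letter. [cite: Balaban1987RG1, Thm 2 (0.31) p.259, (0.20) p.256, §5 p.298] -/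
theorem astar_biLipschitz_of_typedTheorem2 {hL : Odd S.L ∧ 1 < S.L} (h : Theorem2Statement S hL)
    {γu θ C c : ℝ} {Λ : ℕ → ℕ → ℝ} (hγu : 0 < γu)
    (hrg : ∀ P : B12.RunParams, Step.InInterval γu P.K (S.cpl P) → RGEqH P.K S.β (S.cpl P))
    (hS : ScaleShiftRate c θ γu S.β) (hL' : HistLipschitz Λ γu S.β) (hΛ : FadingMemory C θ Λ)
    (hθ0 : 0 < θ) (hθ1 : θ < 1) (hC : 0 ≤ C) (hc : 0 ≤ c) (m : ℕ) :
    ∃ g₆ : ℝ, 0 < g₆ ∧ ∀ (g g' : ℕ → ℕ → ℝ) (gIR gIR' : ℝ),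
      (∀ K, ∃ (m' : ℕ) (g₀ : ℝ), g K = S.cpl ⟨K, m', g₀⟩) → (∀ K, ∃ (m' : ℕ) (g₀ : ℝ), g' K = S.cpl ⟨K, m', g₀⟩) →
      (∀ K, Step.InInterval γu K (g K)) → (∀ K, Step.InInterval γu K (g' K)) →
      (∀ K, g K K = gIR) → (∀ K, g' K K = gIR') → gIR ≤ gIR' → gIR' ≤ g₆ →
      (∀ m', 2 / 3 * (1 / gIR ^ 2 - 1 / gIR' ^ 2) ≤ 1 / (gstar g m') ^ 2 - 1 / (gstar g' m') ^ 2 ∧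
        1 / (gstar g m') ^ 2 - 1 / (gstar g' m') ^ 2 ≤ 4 / 3 * (1 / gIR ^ 2 - 1 / gIR' ^ 2)) ∧
      (gIR < gIR' → ∀ m', gstar g m' < gstar g' m') := by
  obtain ⟨t₀, gs, bs, bs', hgs, hbs, -, hrunt, hboxt, hpint, h031, -⟩ := referenceFamily_of_typedTheorem2 h hγu hrg m
  obtain ⟨e₀, he₀, hthr⟩ := threshold_exists_quarter (γ := γu) (θ := θ) (C := C) gs hγu.le hgs.le hθ1 hC hbs
  refine ⟨e₀, he₀, fun g g' gIR gIR' hrow hrow' hI hI' hpin hpin' hle hle' => ?_⟩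
  have hbox : ∀ K i, i ≤ K → 0 < g K i ∧ g K i ≤ γu := fun K => hI K
  have hbox' : ∀ K i, i ≤ K → 0 < g' K i ∧ g' K i ≤ γu := fun K => hI' K
  have hrun : ∀ K, RGEqH K S.β (g K) := fun K => by
    obtain ⟨m', g₀', hK⟩ := hrow K
    rw [hK]
    exact hrg ⟨K, m', g₀'⟩ (by rw [← hK]; exact hI K)
  have hrun' : ∀ K, RGEqH K S.β (g' K) := fun K => by
    obtain ⟨m', g₀', hK⟩ := hrow' K
    rw [hK]
    exact hrg ⟨K, m', g₀'⟩ (by rw [← hK]; exact hI' K)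
  have hgIR : 0 < gIR := by rw [← hpin 0]; exact (hbox 0 0 le_rfl).1
  have hgIR' : 0 < gIR' := by rw [← hpin' 0]; exact (hbox' 0 0 le_rfl).1
  obtain ⟨hs1, hs2, hs3⟩ := hthr gIR' hgIR' hle'
  have hA := astar_twoSided_of_reference g g' _ hθ0 hθ1 hC hc hbs hS hL' hΛ hrun hbox hpin hrun' hbox' hpin' hrunt hboxt hpint h031 hle
    hs1 hs2 hs3
  -- the `InjectedRate`s once more, for `astar = 1∕gstar²` and positivity
  have h1θ : 0 < 1 - θ := by linarith
  have hQ0 : 0 ≤ C * γu / (1 - θ) ^ 2 + C / (1 - θ) * gs + (2 * C / ((1 - θ) * bs)) ^ 2 + 1 / (4 * gs ^ 2) := by positivity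
  have hs1e : 4 * C * gIR ≤ bs * (1 - θ) := by nlinarith
  have hs2e : gIR ^ 2 * (C * γu / (1 - θ) ^ 2 + C / (1 - θ) * gs + (2 * C / ((1 - θ) * bs)) ^ 2 + 1 / (4 * gs ^ 2)) ≤ 3 / 4 :=
    le_trans (mul_le_mul_of_nonneg_right (by nlinarith [mul_le_mul hle hle hgIR.le hgIR'.le]) hQ0) hs2
  have h83 : 8 * gIR ^ 3 + 16 * gIR / bs ≤ 8 * gIR' ^ 3 + 16 * gIR' / bs := by
    have : gIR ^ 3 ≤ gIR' ^ 3 := pow_le_pow_left₀ hgIR.le hle 3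
    have : 16 * gIR / bs ≤ 16 * gIR' / bs := div_le_div_of_nonneg_right (by linarith) hbs.le
    linarith
  have hs3e : C * (8 * gIR ^ 3 + 16 * gIR / bs) ≤ (1 - θ) / 2 := by nlinarith [mul_le_mul_of_nonneg_left h83 hC]
  have hs3' : C * (8 * gIR' ^ 3 + 16 * gIR' / bs) ≤ (1 - θ) / 2 := by linarith
  have hinj := injectedRate_of_reference g _ hθ0 hθ1 hC hc hbs hS hL' hΛ hrun hbox hpin hrunt hboxt hpint h031 hs1e hs2e hs3e
  have hinj' := injectedRate_of_reference g' _ hθ0 hθ1 hC hc hbs hS hL' hΛ hrun' hbox' hpin' hrunt hboxt hpint h031 hs1 hs2 hs3'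
  have hA' : ∀ m', 2 / 3 * (1 / gIR ^ 2 - 1 / gIR' ^ 2) ≤ 1 / (gstar g m') ^ 2 - 1 / (gstar g' m') ^ 2 ∧
      1 / (gstar g m') ^ 2 - 1 / (gstar g' m') ^ 2 ≤ 4 / 3 * (1 / gIR ^ 2 - 1 / gIR' ^ 2) := fun m' => by
    rw [T4ContinuumCoupling.one_div_gstar_sq hθ1 hinj hbox m', T4ContinuumCoupling.one_div_gstar_sq hθ1 hinj' hbox' m']
    exact hA m'
  refine ⟨hA', fun hlt m' => ?_⟩
  have hpos := T4ContinuumCoupling.gstar_pos hθ1 hinj hbox m'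
  have hpos' := T4ContinuumCoupling.gstar_pos hθ1 hinj' hbox' m'
  have hD : 0 < 1 / gIR ^ 2 - 1 / gIR' ^ 2 :=
    sub_pos.mpr (one_div_lt_one_div_of_lt (pow_pos hgIR 2) (by nlinarith [mul_lt_mul'' hlt hlt hgIR.le hgIR.le]))
  have h1 := (hA' m').1
  have hsq : 1 / (gstar g' m') ^ 2 < 1 / (gstar g m') ^ 2 := by linarith
  have hsq' : (gstar g m') ^ 2 < (gstar g' m') ^ 2 := (one_div_lt_one_div (pow_pos hpos' 2) (pow_pos hpos 2)).mp hsq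
  exact (pow_lt_pow_iff_left₀ hpos.le hpos'.le two_ne_zero).mp hsq'

end

end Summit.QuantumFields.BalabanUV.Beta.EriceFlowEnclosureB12AsPrintedHistoryContagionShiftPin
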